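import Summits.BirchSwinnertonDyer.BirchSwinnertonDyer.Theses.EisensteinPrimes
import Summits.BirchSwinnertonDyer.Rank1Residual.X2.TamagawaSqueeze
import Summits.BirchSwinnertonDyer.Rank1Residual.X2.RankOneHeegnerExact
import Summits.BirchSwinnertonDyer.Rank1Residual.X2.IsogenyClassStability
import Summits.BirchSwinnertonDyer.BirchSwinnertonDyer.Theorems.EisensteinPrimesMazurMCOnCellBLocate
import Summits.BirchSwinnertonDyer.BirchSwinnertonDyer.Theorems.EisensteinPrimesMazurMCOnCellBMuPartTightParity
import Literature.Barriers.BirchSwinnertonDyer.EisensteinMuConjecture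
import Literature.NumberTheory.EllipticCurves.TateCurve.NumberFieldUniformization
import Literature.NumberTheory.EllipticCurves.TateCurve.NumberFieldUniformizationTwisted
import HarnessLib

/-!
# Crux `MazurMCOnCellB` (stmt-BirchSwinnertonDyer-19033) — line `mudescent` (skeleton v4, LEAD bsd-line-x2-p1 g2 2026-08-28:
# BOTH open stubs RE-CUT to the crux-tight form — stub 3′ `stub_muPart_offLocus` («μ_an ≤ μ_alg» at the étale end, replacing
# `μ_an = 0`: Greenberg's Conj. 1.11 is no longer an input) and stub 4″ `stub_lambdaCountWeak_offLocus` (slack `e + 1`, the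
# parity conjuncts of v3 DISCHARGED in the kernel by the Mazur–Tate–Teitelbaum functional equation, `X2.analyticLambdaEq_parity`);
# v4 ⟺ crux granted `PublishedInputs` + Prop. 3.10 (`…MuPartTightCrux.mazurMCOnCellB_iff_forall_offLocus_parity`, p611383);
# `stub_locate` LANDED p443911; tower budget p608923/p609450/p609840; μ-tolerant parity route T p610700/p611137):
# the Λ-adic isogeny μ-descent

Route `EisensteinPrimes` (rung K5), crux rank 3 = row A10 of the FULL-BSD rank-≤1 programme (corner
X2, sub-cell X2b: `r_an = 0`, `p` an odd prime of MULTIPLICATIVE reduction with `E[p]` reducible,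
Greenberg–Vatsal parity FAILING = type A; 83 split + 44 non-split census cells at `p = 3`):
`MazurMCOnCellB := ∀ W p, X2.CellB W p → X2.MazurMainConjectureAt W p`.

THE LINE (judge J ask (γ) / K5 judge note (d); TARGET §1.2 road K5 = K-T3 + K-T4; barrier entry
`Literature.Barriers.BirchSwinnertonDyer.EisensteinMuBarrier`, evasions_known (2) «ISOGENY DESCENT —
prove the conjecture for the `μ = 0` member predicted by Greenberg's Conj. 1.11 and transport it by the
exact isogeny formulas»). On a type-A class every rational `p`-line is unramified-even or ramified-odd,
and the member CARRYING a ramified-odd line has `μ(X(E/ℚ_∞)) ≥ 1` (Greenberg LNM 1716 Prop. 5.7 =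
the barrier's locus `HasRamifiedOddLineAt`), so no «`μ = 0`» road can start there. The line:
* DESCEND (stub 2, `stub_locate`, LANDED p443911 — Galois bookkeeping + Shafarevich finiteness, the
  mirror image of the tree's `X1.GoodLatticeExists`): every X2b pair `(E, p)` is `ℚ`-isogenous to a
  pair `(E₀, p)` OFF the barrier locus (no ramified-odd rational `p`-line: the «étale end» of the
  `p`-isogeny graph, Greenberg's predicted `μ = 0` member, Stevens' minimal curve);
* `μ`-PART OFF THE LOCUS (stub 3′, `stub_muPart_offLocus`, v4; CONSTRUCTION = the reverse μ-inequality
  `μ_an(E₀) ≤ μ_alg(E₀)` of Mazur's main conjecture at the étale end — the Eisenstein multiplicative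
  μ-question, ANALYTIC face: Stevens 1989 Cor. 4.13 / Rem. 4.14, Greenberg–Vatsal 2000 §1 p. 15 «one
  could even conjecture in general that the μ-invariant vanishes for the optimal curve»; per pair =
  the census certificate `X2.AnalyticMuLE W₀ p 0` (two engines), which gives `μ(ϖ·L) = 0 ≤ μ(char X)`):
  v3's `μ_an(E₀) = 0` was this μ-part PLUS Greenberg's Conj. 1.11 `μ_alg(E₀) = 0`
  (`…MuPartTight.analyticMuLE_zero_iff_muPart_and_forall_mu_eq_zero`); the crux needs only the μ-part,
  so Conj. 1.11 is neither an input nor a by-product of v4;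
* `λ`-COUNT OFF THE LOCUS (stub 4″, `stub_lambdaCountWeak_offLocus`, v4; CONSTRUCTION = Greenberg–Vatsal's
  λ-count `λ = λ_φ + λ_ψ + Σδ` EXTENDED TO TYPE A, where the quotient character's Selmer condition at
  `p` is relaxed — Greenberg LNM 1716 p. 119 «one can pursue the situation of proposition 5.10 much
  further» stops exactly here; per pair = `AlgebraicLambdaGE` by the TOWER budget on census Tamagawa
  rows, `Theorems/EisensteinPrimesX2TowerBudgetTorsion{,Discharged}` p608923/p609450, + the analytic
  certificate `λ_an = n`): `λ_alg(E₀) ≥ λ_an(E₀) − e − 1` (`e = 1` at split `p`: the trivial zero; the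
  extra `1` is the parity slack, closed by Greenberg's Prop. 3.10 = stub 1b and the KERNEL parity
  `λ_an ≡ r_an + e` from the Mazur–Tate–Teitelbaum functional equation, `X2.analyticLambdaEq_parity`);
* SQUEEZE + ASCEND (composition, KERNEL theorems already in the tree): the μ-TOLERANT PARITY route T at
  `p ‖ N` (`…MuPartTightParity.mazurMainConjectureAt_of_muPart_of_lambdaCountParity`, p611137: Wuthrich
  Thm. 16 + `ϖ·L ≠ 0` (a theorem at `r_an = 0`, `…X2AnalyticMuBound`) + μ-part + `λ_an = n` + `λ_alg ≥ k`,
  `n ≤ k + e + 1`, `n ≡ r_an + e` + Prop. 3.10 ⇒ MC at `(E₀, p)`), then Mazur's MC is a `ℚ`-isogeny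
  invariant at a rank-`0` X2 pair (`X2.mazurMainConjectureAt_of_isIsogenous` — in print the Λ-adic
  isogeny formulas of Schneider 1987 / Perrin-Riou 1989 Théorème p. 349; in the kernel it drops out of
  `MC ⟺ BSDp` (Wuthrich Thm. 16, Stein–Wuthrich, GZK) and Cassels' invariance), and the sub-cell X2b is
  an isogeny-class property (`X2.cellB_iff_of_isIsogenous`, Tate uniformisation A40/A41 DISCHARGED).
  CONVERSELY the crux implies stubs 3′ and 4″ (`…MuPartTightCrux.mazurMCOnCellB_iff_forall_offLocus_parity`,
  p611383): v4 is EQUIVALENT to the crux granted stubs 1, 1b — no surplus left to cut.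
* PUBLISHED inputs (stub 1, fact-grade) = the route's own support item `PublishedInputs`
  (stmt-…-19037; glue `PublishedInputsOfParts` CLOSED p427323): conjuncts 2 (Cassels), 5–6
  (modularity), 11 (GZK), 15 (Wuthrich 2014 Thm. 16, multiplicative reducible), 16–19 (Stein–Wuthrich
  2013), 20 (Greenberg–Stevens) are consumed.

BARRIER STORY (D-0021). `EisensteinMuBarrier` blocks «`μ = 0`» roads on the locus `HasRamifiedOddLineAt`;
this line EVADES it by construction: stubs 3′–4″ are stated ONLY off the locus (hypothesis
`¬ HasRamifiedOddLineAt W₀ p`), and stub 2 moves every pair off the locus inside its isogeny class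
before any `μ`-statement is made; the ascent back to the displayed member is `μ`-insensitive.
`ReducibleAnticyclotomicAtBadP` (scope wall: no printed anticyclotomic input at `Mult ∧ Red`) is not
touched: the line is purely CYCLOTOMIC (Kato–Wuthrich + Greenberg–Vatsal bookkeeping), no Heegner /
BDP / Beilinson–Flach input — which is also why it is Keller–Yin-3.0.8-FREE (KY-WAKE ADDENDUM-4 item 2).

HONEST FRAMING: nothing here proves a main conjecture; stubs 3′–4″ are OPEN class-wide (jointly they ARE the crux at the étale ends) (print: Greenberg–
Vatsal treat type B only; type A = «we can prove very little», GV p. 5; Bellaïche–Pollack 2019 /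
Pollack–Wake 2025 give exact `μ` in families only; Ray, JKMS 62 (2025) Thm. 1 is CONDITIONAL on his
Conj. 1.2); stub 2 is a kernel exercise; stub 1 is published mathematics taken as displayed hypotheses
exactly as the route's `Assembly` takes it. `Disproof.lean` for this crux: none (`ledger crux ls`,
2026-08-26T10:4xZ; re-checked 2026-08-28T07:1xZ). Sibling registered line: `bysign` (k5-c3 g0; excluded middle on the reduction
sign; its `stub_split` is the whole split half) — `mudescent` is sign-free and attacks both halves by
one mechanism; the two lines share only stub 1.
-/

-- `Summit.BirchSwinnertonDyer.BirchSwinnertonDyer.…`: the summit and its single sub-problem share a name (D-0017 layout).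
set_option linter.dupNamespace false
set_option autoImplicit false

namespace Summit.BirchSwinnertonDyer.BirchSwinnertonDyer.Cruxes.MazurMCOnCellB.Mudescent

open scoped MatrixGroups ModularForm
open WeierstrassCurve CongruenceSubgroup
open Literature.NumberTheory.EllipticCurves Literature.NumberTheory.EllipticCurves.Rank1Residual
  Literature.NumberTheory.EllipticCurves.ModularForms
open Literature.Barriers.BirchSwinnertonDyer (HasRamifiedOddLineAt)
open Summit.BirchSwinnertonDyer.Rank1Residual.X1.MuLambda (mu)
open Summit.BirchSwinnertonDyer.Rank1Residual
open Summit.BirchSwinnertonDyer.BirchSwinnertonDyer.Theses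

/-- **Stub 1 — the PUBLISHED inputs** (fact-grade; VERBATIM the route's support item
`EisensteinPrimes.PublishedInputs` = stmt-BirchSwinnertonDyer-19037, twenty cited tree `Prop`s of
which this line consumes Cassels' isogeny invariance of the BSD quotient, modularity (parametrisation,
newform), Gross–Zagier–Kolyvagin (rank = analytic rank ≤ 1, Ш finite), Wuthrich 2014 Thm. 16 at a
reducible multiplicative prime, Stein–Wuthrich 2013 Thm. 6.1 (split / non-split) with the canonical
multiplicative heights, and Greenberg–Stevens 1993). Never provable as a whole (cite-only Literature
constants); carried exactly as the route's `closes` carries it.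
[cite: Wuthrich2014, Thm. 16 (p. 397)] [cite: SteinWuthrich2013, Thm. 6.1] [cite: GreenbergStevens1993, Thm.] -/
theorem stub_publishedInputs : EisensteinPrimes.PublishedInputs := by
  sorry

/-- **Stub 1b — Greenberg 1999 Prop. 3.10 (FACT-grade, cite-only): `corank_{ℤ_p} Sel_{p^∞}(E/ℚ) ≡
λ(X(E/ℚ_∞)) (mod 2)`** for `p` odd and every torsion cyclotomic dual datum — the tree's named fact
`Greenberg1999.prop310_selmerCorank_mod_two_eq_lambdaInvariant` (no `_holds`: a control theorem with
bounded kernels over the layers). It is the parity input of the PARITY form of route T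
(`X2.mazurMainConjectureAt_of_algebraicLambdaGE_of_parity`) used by the re-cut λ-stub below; NOT a
conjunct of `EisensteinPrimes.PublishedInputs` (stub 1), hence its own cite-only stub (planner: fold
into the support item if the line is ever closed this way). [cite: GreenbergLNM1716, Prop. 3.10 (end of §3)] -/
theorem stub_prop310 : Greenberg1999.prop310_selmerCorank_mod_two_eq_lambdaInvariant := by
  sorry

-- Stub 2 `stub_locate` (DESCEND) LANDED: `Theorems/EisensteinPrimesMazurMCOnCellBLocate.lean` (p443911,
-- ky g7; core in `Theorems/EisensteinPrimesMazurMCOnX1RankZeroLocate.lean` p443510) — consumed below by name.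

/-- **Stub 3′ (re-cut v4) — THE μ-PART OFF THE LOCUS: `μ_an ≤ μ_alg` at the étale end** (the
reverse μ-inequality of Mazur's main conjecture in the Eisenstein multiplicative case; OPEN class-wide).
For every X2b pair `(W₀, p)` with no ramified-odd rational `p`-line, every cyclotomic datum
`(κ, γ)`, every newform `f` of `W₀`, every Néron-normalising `ϖ` (`ϖ·Ω_E = Ω⁺_f`), THE
Mazur–Tate–Teitelbaum function `L` at `p ‖ N`, every Pontryagin-dual datum `D` of `Sel_{p^∞}(E₀/ℚ_∞)`,
every generator `g` of `char_Λ X(E₀/ℚ_∞)` and every `G ∈ Λ` with `ι(G) = ϖ·L`: `μ(G) ≤ μ(g)` — the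
INLINE μ-part of `Theorems/EisensteinPrimesMazurMCOnCellBMuPartTight` (X2 twin of `X1.MuLambda.MuPartAt`),
Kato–Wuthrich (stub 1) being `μ(g) ≤ μ(G)`. WHY THE RE-CUT (planner pre-approval HOME STATUS
2026-08-28T07:06:50Z; kernel `…MuPartTightCrux`, p611383): v3's stub 3 `X2.AnalyticMuLE W₀ p 0`
(`μ_an(W₀) = 0`) ⟺ [this μ-part] ∧ [Greenberg's `μ(X(W₀/ℚ_∞)) = 0`]
(`…MuPartTight.analyticMuLE_zero_iff_muPart_and_forall_mu_eq_zero`), and the crux needs only the first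
conjunct: keeping Conj. 1.11 inside the skeleton was a stub mis-cut (L4). The per-pair CERTIFICATE is
unchanged — `X2.AnalyticMuLE W₀ p 0` (two engines) implies this stub at the pair a fortiori — and so is
the print record: predicted by Stevens (Λ-integrality Conj. IV + Cor. 4.13/Rem. 4.14: `μ ≥` the
`μ`-type depth, `0` at `A_min`) and by Greenberg–Vatsal §1 p. 15 («one could even conjecture in general
that the μ-invariant vanishes for the optimal curve in an isogeny class»); PROVED only in families
(Bellaïche–Pollack 2019, tame level 1; Pollack–Wake 2025, prime level, analytic side); on type A
Greenberg–Vatsal's Eisenstein congruence Thm. (3.11)/(3.12) reads the other branch («we can prove very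
little», GV p. 5). [cite: Stevens1989, Conj. IV (4.5), Cor. 4.13, Rem. 4.14 (p. 93–95)]
[cite: GreenbergVatsal2000, §1 p. 15, §3 Rem. (3.9) (p. 40) and p. 4–5] [cite: GreenbergLNM1716, Conj. 1.11 (p. 58)]
[cite: BellaichePollack2019, Thms. 1.1–1.2] [cite: PollackWake2025, Thms. 1.1–1.2] [cite: Wuthrich2014, Thm. 16 (p. 397)] -/
theorem stub_muPart_offLocus :
    ∀ (W₀ : WeierstrassCurve ℚ) [W₀.IsElliptic] [W₀.IsGloballyMinimal] (p : ℕ) [Fact p.Prime],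
      X2.CellB W₀ p → ¬ HasRamifiedOddLineAt W₀ p →
      ∀ (κ : ZpExtension ℚ p) (γ : Field.absoluteGaloisGroup ℚ),
        κ.IsCyclotomic → κ.IsTopGenerator γ → IsCyclotomicVariable p γ →
        ∀ {N : ℕ} [NeZero N] (f : CuspForm (Gamma0 N) 2), IsNewformOf W₀ f →
        ∀ (ϖ : ℚ), (ϖ : ℝ) * W₀.realPeriodRat = plusPeriod f →
        ∀ (L : PowerSeries ℚ_[p]),
          (W₀.HasSplitMultiplicativeReductionAtPrime p → IsSplitMultPAdicLFunctionOf f p L) →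
          (¬ W₀.HasSplitMultiplicativeReductionAtPrime p → IsMultPAdicLFunctionOf f p (-1) L) →
        ∀ (D : W₀.SelmerDualData κ γ) (g G : IwasawaAlgebra p), D.charIdeal = Ideal.span {g} →
          iwasawaToPowerSeries p G = PowerSeries.C ((ϖ : ℚ) : ℚ_[p]) * L → mu G ≤ mu g := by
  sorry

/-- **Stub 4″ (re-cut v4) — THE λ-COUNT OFF THE LOCUS WITH PARITY SLACK: `λ_an ≤ λ_alg + e + 1` at
the étale end** (Greenberg–Vatsal's λ-count extended to type A; OPEN class-wide). For every X2b pair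
`(W₀, p)` with no ramified-odd rational `p`-line there are `n k : ℕ` with `λ_an(W₀, p) = n`
(`X2.AnalyticLambdaEq`, trivial zero included), `λ(X(W₀/ℚ_∞)) ≥ k` for every cyclotomic torsion dual
datum (`X1.TamagawaSqueeze.AlgebraicLambdaGE`), and `n ≤ k + 1` at a non-split, `n ≤ k + 2` at a split
multiplicative `p`. WHY THE RE-CUT (LEAD g2, 2026-08-28): v3's stub 4 also demanded `Even n` (non-split)
/ `Odd n` (split); but for the TYPED datum `λ_an ≡ r_an + e (mod 2)` is a KERNEL THEOREM from the
functional equation of the Mazur–Tate–Teitelbaum function at `p ‖ N` (`X2.analyticLambdaEq_parity`,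
needing only SOME `μ`-certificate, which exists at `r_an = 0`:
`…X2AnalyticMuBound.exists_analyticMuLE_of_analyticRank_eq_zero`), and `r_an = 0` on X2b — so the
parity conjuncts were dischargeable surplus (stub mis-cut, L4); the composition below discharges them.
The ALGEBRAIC half is delivered in the kernel over the cyclotomic TOWER at the étale end on census
Tamagawa rows (`Theorems/EisensteinPrimesX2TowerBudgetTorsion{,Discharged}`, p608923 / p609450:
`λ_alg ≥ Σ_v p^{min(n,m_v)} − pⁿm′ − 2·v_p(#tors)`, every layer); the ANALYTIC half (`λ_an = n` with
`n` at most that budget `+ e + 1`) is THEOREM B′ on the Mazur twin family (paper, aside -24278;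
kernel socket `Theorems/EisensteinPrimesMazurTwinFamilyTowerRouteT{,Parity}` p610481 / p611146) and the
cell's C^rel / C^mix instrument elsewhere (lam-a MEMO-10…12). In print: GV §2 prove
`λ_{E,Σ₀} = λ_φ + λ_ψ + Σδ` under (GV) parity only; on type A Greenberg LNM 1716 §5 p. 119 («one can
pursue the situation of proposition 5.10 much further») and Conj. 1.11 stop here.
[cite: GreenbergVatsal2000, §2 Props. (2.4)–(2.8) and p. 10–11] [cite: MazurTateTeitelbaum1986Invent, §I.17–I.18]
[cite: GreenbergLNM1716, Prop. 3.10 (p. 82), Prop. 5.10 (p. 118), p. 119 and Cor. 5.6 (p. 111)] [cite: Wuthrich2014, Thm. 16 (p. 397)] -/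
theorem stub_lambdaCountWeak_offLocus :
    ∀ (W₀ : WeierstrassCurve ℚ) [W₀.IsElliptic] [W₀.IsGloballyMinimal] (p : ℕ) [Fact p.Prime],
      X2.CellB W₀ p → ¬ HasRamifiedOddLineAt W₀ p →
        ∃ n k : ℕ, X2.AnalyticLambdaEq W₀ p n ∧ X1.TamagawaSqueeze.AlgebraicLambdaGE W₀ p k ∧
          (¬ W₀.HasSplitMultiplicativeReductionAtPrime p → n ≤ k + 1) ∧
          (W₀.HasSplitMultiplicativeReductionAtPrime p → n ≤ k + 2) := by
  sorry

/-- **Composition — the Λ-adic isogeny μ-descent (v4)**: the crux `MazurMCOnCellB` BY NAME from the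
registered stubs and the LANDED `stub_locate` (p443911). Given an X2b pair `(W, p)`: DESCEND to `W₀`
off the locus (stub 2); `X2.CellB W₀ p` (`X2.cellB_iff_of_isIsogenous`, Tate uniformisation facts
discharged in the tree); at `(W₀, p)`: the Mazur–Tate–Teitelbaum function does not vanish
(`r_an(W₀) = 0`, `…X2AnalyticMuBound.exists_analyticMuLE_of_analyticRank_eq_zero`, modularity +
Greenberg–Stevens from stub 1), the parity `λ_an ≡ r_an + e` (`X2.analyticLambdaEq_parity`, MTT
functional equation, Wuthrich integrality + modularity from stub 1), then Mazur's main conjecture at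
`(W₀, p)` by the μ-TOLERANT PARITY route T
(`…MuPartTightParity.mazurMainConjectureAt_of_muPart_of_lambdaCountParity`, p611137: Wuthrich Thm. 16
and GZK from stub 1, Greenberg Prop. 3.10 from stub 1b, the μ-part from stub 3′, the λ-count from
stub 4″); ASCEND along the isogeny (`X2.mazurMainConjectureAt_of_isIsogenous`, fed by stub 1's
Wuthrich / Stein–Wuthrich / GZK / modularity / Cassels / Greenberg–Stevens conjuncts). `¬ GVPar` is
used only through `CellB` transport. Conversely the crux implies both stubs
(`…MuPartTightCrux.mazurMCOnCellB_iff_forall_offLocus_parity` with the parity conjuncts dropped), so v4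
carries no surplus. [cite: GreenbergLNM1716, Conj. 1.11 and p. 58 ([Sch3], [Pe2])] [cite: PerrinRiou1989Isogenie, Théorème (p. 349)]
[cite: Wuthrich2014, Thm. 16 and Lemma 17 (p. 397)] [cite: MazurTateTeitelbaum1986Invent, §I.17] -/
theorem MazurMCOnCellB_of :
    Summit.BirchSwinnertonDyer.BirchSwinnertonDyer.Theses.EisensteinPrimes.MazurMCOnCellB := by
  unfold Summit.BirchSwinnertonDyer.BirchSwinnertonDyer.Theses.EisensteinPrimes.MazurMCOnCellB
  intro W _ _ p _ hc
  have hP : EisensteinPrimes.PublishedInputs := stub_publishedInputs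
  have hCassels := hP.2.1
  have hpar := hP.2.2.2.2.1
  have hnf := hP.2.2.2.2.2.1
  have hGZK := hP.2.2.2.2.2.2.2.2.2.2.1
  have hWu := hP.2.2.2.2.2.2.2.2.2.2.2.2.2.2.1
  have hJs := hP.2.2.2.2.2.2.2.2.2.2.2.2.2.2.2.1
  have hJn := hP.2.2.2.2.2.2.2.2.2.2.2.2.2.2.2.2.1
  have hHs := hP.2.2.2.2.2.2.2.2.2.2.2.2.2.2.2.2.2.1
  have hHn := hP.2.2.2.2.2.2.2.2.2.2.2.2.2.2.2.2.2.2.1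
  have hGS := hP.2.2.2.2.2.2.2.2.2.2.2.2.2.2.2.2.2.2.2
  -- DESCEND
  obtain ⟨W₀, _, _, hiso, hoff⟩ :=
    Summit.BirchSwinnertonDyer.BirchSwinnertonDyer.Theorems.EisensteinPrimesMazurMCOnCellBLocate.stub_locate W p hc
  have hc₀ : X2.CellB W₀ p :=
    (X2.cellB_iff_of_isIsogenous (p := p) TateCurve.Silverman1994_thmV53_tateUniformisation_holds
      TateCurve.Silverman1994_thmV53_corV54_tateUniformisation_holds hiso).mp hc
  have hp2 : p ≠ 2 := hc₀.2.1.1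
  have hred₀ : ¬ W₀.HasIrreducibleModPGaloisRep p := hc₀.2.1.2.1
  have hmult₀ : W₀.HasMultiplicativeReductionAtPrime p := hc₀.2.1.2.2
  have hr₀ : W₀.analyticRank = 0 := hc₀.1
  -- at the étale end: non-vanishing, μ-part (stub 3′), λ-count (stub 4″), parity (kernel), route T
  obtain ⟨m, hμm⟩ : ∃ m : ℕ, X2.AnalyticMuLE W₀ p m :=
    Summit.BirchSwinnertonDyer.BirchSwinnertonDyer.Theorems.EisensteinPrimesX2AnalyticMuBound.exists_analyticMuLE_of_analyticRank_eq_zero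
      hpar hp2 (hGS W₀ p) hr₀
  have hμ₀ := stub_muPart_offLocus W₀ p hc₀ hoff
  obtain ⟨n, k, hlam, halg, hkN, hkS⟩ := stub_lambdaCountWeak_offLocus W₀ p hc₀ hoff
  obtain ⟨hevN, hoddS⟩ := X2.analyticLambdaEq_parity hWu hpar W₀ p hp2 hmult₀ hred₀ hμm hlam
  have hMC₀ : X2.MazurMainConjectureAt W₀ p :=
    Summit.BirchSwinnertonDyer.BirchSwinnertonDyer.Theorems.EisensteinPrimesMazurMCOnCellBMuPartTightParity.mazurMainConjectureAt_of_muPart_of_lambdaCountParity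
      hWu stub_prop310 hGZK W₀ p hp2 hmult₀ hred₀ (by rw [hr₀]; exact zero_le_one) ⟨m, hμm⟩ hμ₀ hlam halg
      (fun hns ↦ ⟨hkN hns, hevN hns⟩) (fun hs ↦ ⟨hkS hs, hoddS hs⟩)
  -- ASCEND along `W₀ ∼ W`
  exact X2.mazurMainConjectureAt_of_isIsogenous hWu hJs hJn hHs hHn hGZK hnf hpar hCassels hGS
    hiso.symm_of_charZero p hp2 hmult₀ hred₀ hr₀ hMC₀

end Summit.BirchSwinnertonDyer.BirchSwinnertonDyer.Cruxes.MazurMCOnCellB.Mudescent
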